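import Literature.NumberTheory.QuadraticForms.HilbertReciprocityRat
import Literature.NumberTheory.QuadraticForms.DiagonalFormIsotropyAlgebra
import HarnessLib

/-!
# A ternary form is anisotropic at an even number of places (Hilbert reciprocity; Serre IV §3.2 Cor. 3)

Topic `NumberTheory/QuadraticForms`; namespace `Literature.NumberTheory.QuadraticForms`. Everything here
is proved. The places at which a nondegenerate ternary diagonal form `⟨c₀, c₁, c₂⟩` over a number field
`K` fails to represent `0` are exactly the places `v` with `(-c₀/c₂, -c₁/c₂)_v = -1` (O'Meara, proof of
66:1 step 3; the tree's `diagIsotropic_three_iff_hilbertSymbol` in each completion), so by Hilbert's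
reciprocity law `∏_v (a, b)_v = 1` (O'Meara 71:18; Serre Ch. III §2.1 Thm 3 for `ℚ`; the tree's named
fact `hilbertReciprocity K a b`, proved for `K = ℚ` as `hilbertReciprocity_rat`) they are finite in
number and their number — finite and archimedean places together — is **even**. This is the parity fact
behind Serre's Ch. IV §3.2 Cor. 3 ("if `f` represents `0` in all the `ℚ_v` except at most one, then `f`
represents `0`": "the two families `ε_v(f)`, `(-1, -d(f))_v` satisfy the product formula").

* `ternary_anisotropic_places_even` — any number field `K`, from `hilbertReciprocity K` for the pair
  `(-c₀/c₂, -c₁/c₂)`;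
* `rat_ternary_anisotropic_places_even` — `K = ℚ`, unconditional.

## References

* J.-P. Serre, *A Course in Arithmetic*, GTM 7, Springer 1973, Ch. III §2.1 Thm 3, Ch. IV §3.2 Cor. 3 to
  Thm 8 [corpus:book:serre1973-course-arithmetic p0042]. [Serre1973]
* O. T. O'Meara, *Introduction to Quadratic Forms*, Grundlehren 117, Springer 1963, §71 Thm 71:18, §66
  proof of 66:1 [corpus:book:o-meara1963-introduction-quadratic-forms p0194]. [Omeara1963]
-/

noncomputable section

open NumberField IsDedekindDomain

namespace Literature.NumberTheory.QuadraticForms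

/-- In an extension `L ⊇ K` with `2 ≠ 0`, `⟨c₀, c₁, c₂⟩` fails to represent `0` over `L` iff
`(-c₀/c₂, -c₁/c₂)_L = -1` (`diagIsotropic_three_iff_hilbertSymbol`). [folklore] -/
private theorem not_diagIsotropic_three_map_iff {K L : Type*} [Field K] [Field L] [NeZero (2 : L)]
    (f : K →+* L) {c : Fin 3 → K} (hc : ∀ i, c i ≠ 0) :
    ¬ DiagIsotropic (fun i => f (c i)) ↔ hilbertSymbol L (f (-(c 0 / c 2))) (f (-(c 1 / c 2))) = -1 := by
  have hc' : ∀ i, f (c i) ≠ 0 := fun i => (map_ne_zero f).mpr (hc i)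
  rw [diagIsotropic_three_iff_hilbertSymbol (hc' 0) (hc' 1) (hc' 2), map_neg, map_neg, map_div₀,
    map_div₀]
  constructor
  · intro h
    exact (hilbertSymbol_eq_one_or_eq_neg_one _ _).resolve_left h
  · intro h h1
    rw [h1] at h
    norm_num at h

/-- `2 ≠ 0` in any field extension of a number field. [folklore] -/
private theorem neZero_two_of_algebraMap {K L : Type*} [Field K] [NumberField K] [Field L] [Algebra K L] :
    NeZero (2 : L) := by
  haveI := charZero_of_injective_algebraMap (algebraMap K L).injective
  infer_instance

/-- **A ternary form is anisotropic at an even number of places** (Hilbert reciprocity, O'Meara 71:18,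
applied to `(-c₀/c₂, -c₁/c₂)`; the parity behind Serre IV §3.2 Cor. 3): for a nondegenerate ternary
diagonal form over a number field `K` satisfying Hilbert reciprocity for this pair, the finite places `v`
at which `⟨c⟩` does not represent `0` in `K_v` form a finite set, and together with the archimedean
places at which it does not represent `0` they are even in number. [cite: Omeara1963, §71 Thm. 71:18] -/
theorem ternary_anisotropic_places_even (K : Type) [Field K] [NumberField K] {c : Fin 3 → K}
    (hc : ∀ i, c i ≠ 0) (hrec : hilbertReciprocity K (-(c 0 / c 2)) (-(c 1 / c 2))) :
    {v : HeightOneSpectrum (𝓞 K) |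
        ¬ DiagIsotropic (fun i => algebraMap K (v.adicCompletion K) (c i))}.Finite ∧
      Even ({v : HeightOneSpectrum (𝓞 K) |
              ¬ DiagIsotropic (fun i => algebraMap K (v.adicCompletion K) (c i))}.ncard +
        {w : InfinitePlace K | ¬ DiagIsotropic (fun i => algebraMap K w.Completion (c i))}.ncard) := by
  have ha : -(c 0 / c 2) ≠ 0 := neg_ne_zero.mpr (div_ne_zero (hc 0) (hc 2))
  have hb : -(c 1 / c 2) ≠ 0 := neg_ne_zero.mpr (div_ne_zero (hc 1) (hc 2))
  obtain ⟨hfin, heven⟩ := hrec ha hb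
  have e1 : {v : HeightOneSpectrum (𝓞 K) |
        ¬ DiagIsotropic (fun i => algebraMap K (v.adicCompletion K) (c i))} =
      {v : HeightOneSpectrum (𝓞 K) | hilbertSymbol (v.adicCompletion K)
        (algebraMap K _ (-(c 0 / c 2))) (algebraMap K _ (-(c 1 / c 2))) = -1} := by
    ext v
    haveI : NeZero (2 : v.adicCompletion K) := neZero_two_of_algebraMap (K := K)
    exact not_diagIsotropic_three_map_iff _ hc
  have e2 : {w : InfinitePlace K | ¬ DiagIsotropic (fun i => algebraMap K w.Completion (c i))} =
      {w : InfinitePlace K | hilbertSymbol w.Completion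
        (algebraMap K _ (-(c 0 / c 2))) (algebraMap K _ (-(c 1 / c 2))) = -1} := by
    ext w
    haveI : NeZero (2 : w.Completion) := neZero_two_of_algebraMap (K := K)
    exact not_diagIsotropic_three_map_iff _ hc
  rw [e1, e2]
  exact ⟨hfin, heven⟩

/-- **Over `ℚ`: a ternary form fails to represent `0` at a finite, even number of places** (Hilbert
reciprocity over `ℚ`, Serre Ch. III §2.1 Thm 3, the tree's `hilbertReciprocity_rat`; Serre IV §3.2
Cor. 3: "the two families `ε_v(f)`, `(-1, -d(f))_v` satisfy the product formula"). In particular a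
rational ternary form which represents `0` at all places but at most one represents `0` everywhere.
[cite: Serre1973, Ch. III §2.1 Thm. 3] -/
theorem rat_ternary_anisotropic_places_even {c : Fin 3 → ℚ} (hc : ∀ i, c i ≠ 0) :
    {v : HeightOneSpectrum (𝓞 ℚ) |
        ¬ DiagIsotropic (fun i => algebraMap ℚ (v.adicCompletion ℚ) (c i))}.Finite ∧
      Even ({v : HeightOneSpectrum (𝓞 ℚ) |
              ¬ DiagIsotropic (fun i => algebraMap ℚ (v.adicCompletion ℚ) (c i))}.ncard +
        {w : InfinitePlace ℚ | ¬ DiagIsotropic (fun i => algebraMap ℚ w.Completion (c i))}.ncard) :=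
  ternary_anisotropic_places_even ℚ hc (hilbertReciprocity_rat _ _)

end Literature.NumberTheory.QuadraticForms

end
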